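/-
Copyright (c) 2026. All rights reserved.
Released under Apache 2.0 license as described in the file LICENSE.
Authors: abc-iut cell, WAVE-5 prover seat abc-iut-w5-d180 (gen 10).
-/
import Literature.IUT.LogVolume.EisensteinRadicalDifferent
import Literature.IUT.LogVolume.UnitRadicalDifferentExact
import Mathlib.FieldTheory.Minpoly.IsIntegrallyClosed
import HarnessLib

/-!
# The different of a `p`-adic field containing a `p`-th root of a uniformizer of `ℚ_p`, EXACTLY:
# `d_K = (2e − 1)/e` whenever `p² ∤ e` (the case «W1» of the wild local type, upper side, for EVERY such field)

Classical local algebra (J.-P. Serre, *Corps locaux*, Ch. III §6 Prop. 13 and Remark; Cor. 2 of Prop. 11: Euler's `f′(x) ∈ 𝔇`), in the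
norm-side setting of the cell's [IUTchIV] §1 files (`e = absRamificationIdx p K`, `d = differentOrd p K`, `ord(p) = 1`). PROOF-ONLY sequel
(no definition, no `Prop` fact, no instance) of abc-iut-W-neg-1's `EisensteinRadicalDifferent.lean` (LOWER bound `(2e − 1)/e ≤ d_K` for `K ∋ y`,
`y^p = π`, `‖π‖ = p⁻¹`) and of this seat's `UnitRadicalDifferentExact.lean` (same method for the unit radical). For the genuine completions the
W1 exactness is already the tree's `GenuineK.differentOrd_kOf_eq_wild_ratPoint` (via the global Dedekind–Hensel bound); HERE the ABSTRACT field: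

* **`differentOrd_le_of_pow_prime_eq`** — `p² ∤ e_K ⇒ d_K ≤ (2e − 1)/e`: on `V = ℚ_p(y)` the Eisenstein polynomial `X^p − π` IS the minimal
  polynomial of `y` (`[V:ℚ_p] = e_V = p`), so Euler's lemma (Mathlib `aeval_derivative_mem_differentIdeal`) puts `p·y^{p−1}`, of norm
  `p^{−(2−1/p)}`, in `𝔇_V`, whence `d_V ≤ 2 − 1/p`; and `K/V` is TAMELY ramified (`e(K/V) = e_K/p`), so the tame equality of [IUTchIV]
  Prop. 1.3 (i) (`prop13i_holds`) gives `d_K = d_V + (e_K/p − 1)/e_K ≤ 2 − 1/e_K`;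
* **`differentOrd_eq_of_pow_prime_eq`** — with W-neg-1's lower bound: **`d_K = (2e − 1)/e` EXACTLY** (Ore's bound attained);
  `differentOrd_le_two_sub_inv_of_pow_prime_eq` — the same as `d_K ≤ 2 − 1/e_K`.

Nothing here is disputed mathematics; no abc claim. [cite: SerreLocalFields1979, Ch. III §6 Prop. 13 and Remark; Cor. 2 of Prop. 11]
[cite: Mochizuki2012, IUTchIV Prop. 1.3 (i) p. 11]
-/

noncomputable section

open Metric Set IsLocalRing Module Polynomial
open scoped NormedField IntermediateField

namespace Literature.IUT.LogVolume

section Radical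

variable (p : ℕ) [Fact p.Prime]
variable {K : Type} [NontriviallyNormedField K] [NormedAlgebra ℚ_[p] K] [IsUltrametricDist K] [ProperSpace K]
variable {π : ℚ_[p]} (hπ : ‖π‖ = (p : ℝ)⁻¹) {y : K} (hy : y ^ p = algebraMap ℚ_[p] K π)

include hπ hy

/-- **`d_K ≤ (2e − 1)/e` when `K ∋ y = π^{1/p}`, `‖π‖ = p⁻¹`, and `p² ∤ e_K`.** With `V = ℚ_p(y) ⊆ K`: `e_V = p = [V:ℚ_p]`, the Eisenstein
`X^p − π` is the minimal polynomial of `y`, so `p·y^{p−1} ∈ 𝔇_V` (Euler) has norm `p^{−(2−1/p)}` and `d_V ≤ 2 − 1/p`; `e(K/V) = e_K/p` is prime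
to `p`, so [IUTchIV] Prop. 1.3 (i) holds with EQUALITY: `d_K = d_V + (e_K/p − 1)/e_K ≤ (2e_K − 1)/e_K`.
[cite: SerreLocalFields1979, Ch. III §6 Prop. 13; Cor. 2 of Prop. 11] [cite: Mochizuki2012, IUTchIV Prop. 1.3 (i) p. 11] -/
theorem differentOrd_le_of_pow_prime_eq (he2 : ¬ p ^ 2 ∣ absRamificationIdx p K) :
    differentOrd p K ≤ ((2 * absRamificationIdx p K - 1 : ℕ) : ℝ) / (absRamificationIdx p K : ℝ) := by
  have hpp : p.Prime := Fact.out
  have hp1 : (1 : ℝ) < p := by exact_mod_cast hpp.one_lt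
  have hp0 : (0 : ℝ) < p := by positivity
  haveI : FiniteDimensional ℚ_[p] K := FiniteDimensional.of_locallyCompactSpace ℚ_[p]
  have hyn : ‖y‖ = (p : ℝ) ^ (-(1 / (p : ℝ))) := norm_eq_rpow_of_pow_prime_eq p hπ hy
  have hylt : ‖y‖ < 1 := by
    rw [hyn]
    exact Real.rpow_lt_one_of_one_lt_of_neg hp1 (by
      have : (0 : ℝ) < 1 / (p : ℝ) := by positivity
      linarith)
  -- the subfield `V = ℚ_p(y)`
  haveI : FiniteDimensional ℚ_[p] ℚ_[p]⟮y⟯ := inferInstance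
  haveI : ProperSpace ℚ_[p]⟮y⟯ := FiniteDimensional.proper ℚ_[p] ℚ_[p]⟮y⟯
  letI : NormedAlgebra ℚ_[p]⟮y⟯ K :=
    { (IntermediateField.toAlgebra ℚ_[p]⟮y⟯ : Algebra ℚ_[p]⟮y⟯ K) with
      norm_smul_le := fun v z => by
        rw [Algebra.smul_def, norm_mul]
        rfl }
  have hyV : y ∈ ℚ_[p]⟮y⟯ := IntermediateField.mem_adjoin_simple_self ℚ_[p] y
  -- `p ∣ e_V`
  have hpV : p ∣ absRamificationIdx p ℚ_[p]⟮y⟯ :=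
    prime_dvd_absRamificationIdx_of_norm_eq_rpow p (x := (⟨y, hyV⟩ : ℚ_[p]⟮y⟯)) hyn
  -- `y` is a root of the monic `g = X^p − π` of degree `p`
  have hint : IsIntegral ℚ_[p] y := Algebra.IsIntegral.isIntegral y
  set g : ℚ_[p][X] := X ^ p - C π with hgdef
  have hgdeg : g.natDegree = p := by rw [hgdef, natDegree_X_pow_sub_C]
  have hgmonic : g.Monic := by rw [hgdef]; exact monic_X_pow_sub_C π hpp.ne_zero
  have hg0 : g ≠ 0 := hgmonic.ne_zero
  have hroot : aeval y g = 0 := by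
    rw [hgdef, map_sub, map_pow, aeval_X, aeval_C, hy, sub_self]
  have hmin_dvd : minpoly ℚ_[p] y ∣ g := minpoly.dvd ℚ_[p] y hroot
  have hdeg : Module.finrank ℚ_[p] ℚ_[p]⟮y⟯ ≤ p := by
    rw [IntermediateField.adjoin.finrank hint]
    calc (minpoly ℚ_[p] y).natDegree ≤ g.natDegree := natDegree_le_of_dvd hmin_dvd hg0
      _ = p := hgdeg
  -- `e_V = p`, hence `[V : ℚ_p] = p` and `minpoly = g`
  have heV : absRamificationIdx p ℚ_[p]⟮y⟯ = p := by
    have hfi := absRamificationIdx_mul_residueDegree p ℚ_[p]⟮y⟯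
    have hf := residueDegree_pos p ℚ_[p]⟮y⟯
    have hle : absRamificationIdx p ℚ_[p]⟮y⟯ ≤ p := by
      calc absRamificationIdx p ℚ_[p]⟮y⟯ ≤ absRamificationIdx p ℚ_[p]⟮y⟯ * residueDegree p ℚ_[p]⟮y⟯ :=
            Nat.le_mul_of_pos_right _ hf
        _ = Module.finrank ℚ_[p] ℚ_[p]⟮y⟯ := hfi
        _ ≤ p := hdeg
    exact le_antisymm hle (Nat.le_of_dvd (absRamificationIdx_pos p _) hpV)
  have hfinrank : Module.finrank ℚ_[p] ℚ_[p]⟮y⟯ = p := by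
    refine le_antisymm hdeg ?_
    have hfi := absRamificationIdx_mul_residueDegree p ℚ_[p]⟮y⟯
    have hf := residueDegree_pos p ℚ_[p]⟮y⟯
    calc p = absRamificationIdx p ℚ_[p]⟮y⟯ := heV.symm
      _ ≤ absRamificationIdx p ℚ_[p]⟮y⟯ * residueDegree p ℚ_[p]⟮y⟯ := Nat.le_mul_of_pos_right _ hf
      _ = Module.finrank ℚ_[p] ℚ_[p]⟮y⟯ := hfi
  have hmin_eq : minpoly ℚ_[p] y = g := by
    symm
    refine Polynomial.eq_of_monic_of_dvd_of_natDegree_le (minpoly.monic hint) hgmonic hmin_dvd ?_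
    rw [hgdeg, ← IntermediateField.adjoin.finrank hint, hfinrank]
  -- Euler: `m′(y) ∈ 𝔇_V` for `m` the minimal polynomial of `y` over `ℤ_p`
  set y' : ℚ_[p]⟮y⟯ := IntermediateField.AdjoinSimple.gen ℚ_[p] y with hy'def
  have hy'K : ((y' : ℚ_[p]⟮y⟯) : K) = y := IntermediateField.AdjoinSimple.coe_gen ℚ_[p] y
  have hy'n : ‖y'‖ = (p : ℝ) ^ (-(1 / (p : ℝ))) := by
    change ‖((y' : ℚ_[p]⟮y⟯) : K)‖ = _
    rw [hy'K]
    exact hyn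
  have hy'le : ‖y'‖ ≤ 1 := by
    change ‖((y' : ℚ_[p]⟮y⟯) : K)‖ ≤ 1
    rw [hy'K]
    exact hylt.le
  set yi : Valued.integer ℚ_[p]⟮y⟯ := ⟨y', Valued.integer.mem_iff.mpr hy'le⟩ with hyidef
  have hyiV : ((yi : Valued.integer ℚ_[p]⟮y⟯) : ℚ_[p]⟮y⟯) = y' := rfl
  haveI : Algebra.IsAlgebraic ℚ_[p] ℚ_[p]⟮y⟯ := Algebra.IsAlgebraic.of_finite ℚ_[p] _
  haveI : Algebra.IsSeparable ℚ_[p] ℚ_[p]⟮y⟯ := inferInstance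
  have hgen : Algebra.adjoin ℚ_[p] {y'} = ⊤ := by
    have h := (IntermediateField.adjoin.powerBasis hint).adjoin_gen_eq_top
    rwa [IntermediateField.adjoin.powerBasis_gen] at h
  have hmem : aeval yi (derivative (minpoly ℤ_[p] yi)) ∈ different p ℚ_[p]⟮y⟯ := by
    rw [different_eq]
    exact aeval_derivative_mem_differentIdeal ℤ_[p] ℚ_[p] ℚ_[p]⟮y⟯ yi hgen
  -- identify `m` with `g` over `ℚ_p`
  have hintZ : IsIntegral ℤ_[p] yi := (isIntegral_integer p ℚ_[p]⟮y⟯).isIntegral yi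
  set ι : Valued.integer ℚ_[p]⟮y⟯ →ₐ[ℤ_[p]] ℚ_[p]⟮y⟯ := IsScalarTower.toAlgHom ℤ_[p] (Valued.integer ℚ_[p]⟮y⟯) ℚ_[p]⟮y⟯
    with hιdef
  have hι : ∀ z, ι z = (z : ℚ_[p]⟮y⟯) := fun z => rfl
  have hιinj : Function.Injective ι := fun a b h => Subtype.ext (by rw [← hι a, ← hι b, h])
  have hintZ' : IsIntegral ℤ_[p] y' := by
    have h := (isIntegral_algHom_iff ι hιinj).mpr hintZ
    rwa [hι, hyiV] at h
  have hminZ : (minpoly ℤ_[p] yi).map (algebraMap ℤ_[p] ℚ_[p]) = g := by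
    have h1 : minpoly ℚ_[p] y' = (minpoly ℤ_[p] y').map (algebraMap ℤ_[p] ℚ_[p]) :=
      minpoly.isIntegrallyClosed_eq_field_fractions' ℚ_[p] hintZ'
    have h2 : minpoly ℤ_[p] (ι yi) = minpoly ℤ_[p] yi := minpoly.algHom_eq ι hιinj yi
    have h3 : minpoly ℚ_[p] y' = minpoly ℚ_[p] y := by
      have := minpoly.algHom_eq (IntermediateField.val ℚ_[p]⟮y⟯) Subtype.val_injective y'
      rw [← this]
      rfl
    rw [hι] at h2
    rw [hyiV] at h2
    rw [← h2, ← h1, h3, hmin_eq]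
  -- evaluate: `m′(y) = g′(y) = p·y^{p−1}` in `V`
  have hderg : derivative g = C (p : ℚ_[p]) * X ^ (p - 1) := by
    rw [hgdef, derivative_sub, derivative_C, sub_zero, derivative_X_pow]
  have heval : ((aeval yi (derivative (minpoly ℤ_[p] yi)) : Valued.integer ℚ_[p]⟮y⟯) : ℚ_[p]⟮y⟯) =
      (p : ℚ_[p]⟮y⟯) * y' ^ (p - 1) := by
    rw [← hι, ← aeval_algHom_apply, hι, hyiV, ← aeval_map_algebraMap ℚ_[p] y' (derivative (minpoly ℤ_[p] yi)),
      ← derivative_map, hminZ, hderg, map_mul, aeval_C, map_natCast, map_pow, aeval_X]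
  -- its norm is `p^{−(2 − 1/p)}`
  have hpn : ‖(p : ℚ_[p]⟮y⟯)‖ = (p : ℝ)⁻¹ := by
    rw [norm_natCast_eq_padicNorm p ℚ_[p]⟮y⟯ p, Padic.norm_p]
  have hnorm : ‖((aeval yi (derivative (minpoly ℤ_[p] yi)) : Valued.integer ℚ_[p]⟮y⟯) : ℚ_[p]⟮y⟯)‖ =
      (p : ℝ) ^ (-(2 - 1 / (p : ℝ))) := by
    rw [heval, norm_mul, norm_pow, hy'n, hpn, ← Real.rpow_natCast, ← Real.rpow_mul hp0.le, ← Real.rpow_neg_one,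
      ← Real.rpow_add hp0]
    congr 1
    rw [Nat.cast_sub hpp.one_le, Nat.cast_one]
    field_simp
    ring
  -- hence `d_V ≤ 2 − 1/p`
  have hdV : differentOrd p ℚ_[p]⟮y⟯ ≤ 2 - 1 / (p : ℝ) := by
    refine differentOrd_le_of_mem_different p ℚ_[p]⟮y⟯ hmem ?_
    rw [hnorm]
  -- `e(K/V) = e_K/p` is prime to `p`: the extension `K/V` is tamely ramified
  obtain ⟨-, heq⟩ := prop13i_holds p ℚ_[p]⟮y⟯ K inferInstance
  have hrel : relRamificationIdx p ℚ_[p]⟮y⟯ K * p = absRamificationIdx p K := by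
    have h := relRamificationIdx_mul p ℚ_[p]⟮y⟯ K
    rwa [heV] at h
  have hrel1 := relRamificationIdx_pos p ℚ_[p]⟮y⟯ K
  set r := relRamificationIdx p ℚ_[p]⟮y⟯ K with hrdef
  have htame : IsTamelyRamified p ℚ_[p]⟮y⟯ K := by
    intro hpr
    change p ∣ relRamificationIdx p ℚ_[p]⟮y⟯ K at hpr
    rw [← hrdef] at hpr
    obtain ⟨s, hs⟩ := hpr
    exact he2 ⟨s, by rw [← hrel, hs]; ring⟩
  have hdK := heq htame
  have he := absRamificationIdx_pos p K
  have he0 : (0 : ℝ) < absRamificationIdx p K := by exact_mod_cast he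
  have hcast : ((2 * absRamificationIdx p K - 1 : ℕ) : ℝ) = 2 * (absRamificationIdx p K : ℝ) - 1 := by
    rw [Nat.cast_sub (by omega), Nat.cast_mul]
    norm_num
  have hrR : (r : ℝ) * p = absRamificationIdx p K := by exact_mod_cast hrel
  rw [hcast, hdK]
  -- `d_V + (r − 1)/e ≤ (2 − 1/p) + (r − 1)/e = 2 − 1/e` using `r·p = e`
  have hid : (2 - 1 / (p : ℝ)) + ((r : ℝ) - 1) / absRamificationIdx p K =
      (2 * (absRamificationIdx p K : ℝ) - 1) / absRamificationIdx p K := by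
    rw [← hrR]
    field_simp
    ring
  calc differentOrd p ℚ_[p]⟮y⟯ + ((r : ℝ) - 1) / absRamificationIdx p K
      ≤ (2 - 1 / (p : ℝ)) + ((r : ℝ) - 1) / absRamificationIdx p K := by gcongr
    _ = (2 * (absRamificationIdx p K : ℝ) - 1) / absRamificationIdx p K := hid

/-- **THE W1 DIFFERENT, EXACT (abstract field): `d_K = (2e − 1)/e`** for a `p`-adic field `K ∋ y`, `y^p = π`, `‖π‖ = p⁻¹`, with `p² ∤ e_K` —
abc-iut-W-neg-1's lower bound `sub_one_div_le_differentOrd_of_pow_prime_eq` and the upper bound `differentOrd_le_of_pow_prime_eq` (Ore's bound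
`v_K(𝔇) ≤ e − 1 + v_K(e)` attained: `v_K(𝔇) = 2e − 1`). [cite: SerreLocalFields1979, Ch. III §6 Prop. 13 and Remark]
[cite: Mochizuki2012, IUTchIV Prop. 1.3 (i) p. 11] -/
theorem differentOrd_eq_of_pow_prime_eq (he2 : ¬ p ^ 2 ∣ absRamificationIdx p K) :
    differentOrd p K = ((2 * absRamificationIdx p K - 1 : ℕ) : ℝ) / (absRamificationIdx p K : ℝ) :=
  le_antisymm (differentOrd_le_of_pow_prime_eq p hπ hy he2) (sub_one_div_le_differentOrd_of_pow_prime_eq p hπ hy)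

/-- **`d_K ≤ 2 − 1/e_K`** (closed form of the same bound). [cite: SerreLocalFields1979, Ch. III §6 Prop. 13 and Remark] -/
theorem differentOrd_le_two_sub_inv_of_pow_prime_eq (he2 : ¬ p ^ 2 ∣ absRamificationIdx p K) :
    differentOrd p K ≤ 2 - 1 / (absRamificationIdx p K : ℝ) := by
  have h := differentOrd_le_of_pow_prime_eq p hπ hy he2
  have he := absRamificationIdx_pos p K
  have he0 : (0 : ℝ) < absRamificationIdx p K := by exact_mod_cast he
  have hcast : ((2 * absRamificationIdx p K - 1 : ℕ) : ℝ) = 2 * (absRamificationIdx p K : ℝ) - 1 := by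
    rw [Nat.cast_sub (by omega), Nat.cast_mul]
    norm_num
  rw [hcast] at h
  calc differentOrd p K ≤ (2 * (absRamificationIdx p K : ℝ) - 1) / absRamificationIdx p K := h
    _ = 2 - 1 / (absRamificationIdx p K : ℝ) := by field_simp

end Radical

end Literature.IUT.LogVolume

end
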